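import Summits.Schanuel.Schanuel.Theorems.RootDecomp1ELWTransport08
import Summits.Schanuel.Schanuel.Theorems.RootDecomp1ETwoScale08

/-!
# RootDecomp1ELWTransport — lens 2, generation 39 «LW-PAIR NORM TRANSPORT CELL» (lane E-R18 (a)): S ITSELF on the class `InLWClass` (E-doubled moment curves over a dyadic 2-fold-hyper-Liouville T), engine `algebraicIndependent_lwPt` mod `hLW : LWMeasure` — continuation (RootDecomp1ELWTransport09): §7 CONTROLS (proved negatives) + §8/§9 PORT ADDITIONS: LIVE read-outs of 25020/31409/31410 (`Iff.rfl`) and the separation read against the TREE g35/g36/g37 classes (`Iff.rfl` bridges + `_tree` corollaries) — the ONLY part importing `Theses.RootDecomp1E` (via the tree `RootDecomp1ETwoScale08`)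

(lens-2 g39 `LWTransport.lean` [HOME/decomp-schanuel-lens-2/g39/ sha256 cff5d88d…e8f0, 2208 l; NODE L1907 / REQUEST L1908; critic VERDICT L1909 (CLEARED, E-R18 (a) cell credit, port GO)]; port by census-1 gen 17 as
`RootDecomp1ELWTransport01`–`09` — see the PORT NOTE of part 01; `--supports stmt-Schanuel-31409`; rung 0.)
-/

noncomputable section

open Complex Polynomial
open Literature.NumberTheory.Transcendental (zlen zlen_nonneg zlen_add_le zlen_monomial_le zlen_sum_le
  zlen_mul_le zlen_pow_le)

namespace Summit.Schanuel.Schanuel.Theorems.RootDecomp1ELWTransport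

open Summit.Schanuel.Schanuel.Theorems.RootDecomp1KHyper (SB SFset sb_of_algebraicIndependent LWMeasure
  exists_ball_eval_ne_zero exists_int_mul_eq_map mvaeval_int_map)
open Summit.Schanuel.Schanuel.Theorems.RootDecomp1KHyper.HyperCell (Ewt exC collPoly collPoly_ne_zero
  exC_inj)
open NormDescent (P2)

variable {k : ℕ}

/-! ## §7  CONTROLS (checklist (5)): what fails when a load-bearing line is removed -/

/-- **CONTROL C2 (β ∈ ℚ ⇒ fails).** For rational `β` the engine's point is not even injective
(`β = 1`: `Y₁ = E₁`), so `algebraicIndependent_lwPt` is FALSE there: the irrationality of `β`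
(hypothesis `hβirr`) is load-bearing. -/
theorem control_rational_beta (k : ℕ) (hk : 0 < k) (x : ℂ) :
    ¬ AlgebraicIndependent ℚ (lwPt k 1 x) := by
  intro h
  have hne : (Fin.succ (Fin.castAdd k ⟨0, hk⟩) : Fin (k + k + 1)) ≠ Fin.succ (Fin.natAdd k ⟨0, hk⟩) := by
    intro e
    have := congrArg Fin.val e
    simp only [Fin.val_succ, Fin.val_castAdd, Fin.val_natAdd] at this
    omega
  exact hne (h.injective (by rw [lwPt_Y, lwPt_E, one_mul]))

/-- **CONTROL C1 (1-fold hyper-Liouville ⇒ fails).** With a SINGLE-exponential approximation budget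
`η < exp(−q^m)` (the tree's 1-fold `HyperLiouville` scale) in place of `η < exp(−exp(q^m))`, the
hypotheses of the endgame `endgame_lw` are jointly SATISFIABLE (explicit witnesses), so no
contradiction — the engine proves nothing for 1-fold hyper-Liouville `T`; `DyadicHyper₂` is
load-bearing (the LW measure costs `exp(exp(·))`, only a double-exponential approximant beats it). -/
theorem control_single_exponential_budget :
    ∃ (Φ X η g a q : ℝ) (m e : ℕ), 0 < X ∧ Real.exp (-Φ) ≤ g ∧ g ≤ X * η ∧
      η < Real.exp (-(q ^ m)) ∧ Φ ≤ Real.exp (a * q ^ e) ∧ X ≤ Real.exp (Real.exp (a * q ^ e)) ∧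
      1 ≤ q ∧ a + 1 ≤ q ∧ e + 1 ≤ m := by
  refine ⟨Real.exp 2, Real.exp (Real.exp 2), Real.exp (-5), Real.exp (Real.exp 2) * Real.exp (-5),
    1, 2, 2, 1, Real.exp_pos _, ?_, le_rfl, ?_, ?_, ?_, by norm_num, by norm_num, by norm_num⟩
  · rw [← Real.exp_add]
    refine Real.exp_le_exp.mpr ?_
    have := Real.add_one_le_exp (2 : ℝ)
    linarith
  · exact Real.exp_lt_exp.mpr (by norm_num)
  · exact Real.exp_le_exp.mpr (by norm_num)
  · exact Real.exp_le_exp.mpr (Real.exp_le_exp.mpr (by norm_num))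

/-- **CONTROL C5 (conclusion strengthened past the count ⇒ fails).** Appending the coordinate `T²`
(algebraic over `T`) to the engine's point destroys algebraic independence (`X_last − X_0² ↦ 0`): the
count `2k+1` generic coordinates on the curve is the engine's exact reach, and at `z₄` the credit line
`4 ≤ trdeg` cannot be pushed to `6 ≤ trdeg` (the field `ℚ(z₄, e^{z₄})` is generated by `T⋆`, `i` and
four exponentials, so its transcendence degree is at most 5). -/
theorem control_no_extra_coordinate (k : ℕ) (β x : ℂ) :
    ¬ AlgebraicIndependent ℚ (Fin.snoc (lwPt k β x) (x ^ 2) : Fin (k + k + 1 + 1) → ℂ) := by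
  intro h
  have hne : (Fin.castSucc (0 : Fin (k + k + 1)) : Fin (k + k + 1 + 1)) ≠ Fin.last (k + k + 1) :=
    (Fin.castSucc_lt_last _).ne
  have hP : (MvPolynomial.X (Fin.last (k + k + 1)) - MvPolynomial.X (Fin.castSucc 0) ^ 2 :
      MvPolynomial (Fin (k + k + 1 + 1)) ℚ) ≠ 0 := by
    intro e
    have h1 := congrArg (MvPolynomial.eval fun i => if i = Fin.last (k + k + 1) then (1 : ℚ) else 0) e
    simp at h1
  refine hP ((algebraicIndependent_iff.mp h) _ ?_)
  simp [Fin.snoc_last, lwPt_zero]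

/-! **CONTROL C3 (`_holds` removed ⇒ fails)** is structural: every cell / member theorem above carries the
binder `(hLW : LWMeasure)` and uses it exactly once, inside `algebraicIndependent_lwPt` at the FIXED pair
`(e, e^β)`; it is discharged by the tree theorem `Ably1994_lindemannWeierstrass_measure_holds`
(`LWTransportDischarge.lean`; defs character-identical).  **CONTROL C4 (non-dyadic denominator ⇒ descent
inapplicable):** `NormDescent.step` removes ONE factor 2 from the denominator per application
(`f ↦ ½·f(X,Y)f(−X,Y)f(X,−Y)f(−X,−Y)` on even exponents); for a general denominator `Q = ∏ pᵢ^{eᵢ}` the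
analogous norm to `(e, e^β)` is a product over `pᵢ`-th roots of unity of length `≤ zlen^{Q²}` and needs
the Galois averaging over `ℚ(ζ_Q)` to land in `ℤ[X,Y]` — not implemented; the class is therefore cut to
DYADIC hyper-approximations (`DyadicHyper₂`), which the members `T⋆ = Σ 2^{−a_ν}` satisfy by design. -/

/-! ## §8  The LIVE 1E items read back BY NAME (port addition; this is the ONLY part importing the route file
`Theses.RootDecomp1E`).  The three `Iff.rfl` read-outs of the HOME probe (LWTransportProbe.lean b425d016…, P1–P3: the LIVE
items stmt-Schanuel-25020 / 31409 / 31410 ARE the binder texts carried by `cell_25020` / `cell_31409` / `cell_31410` of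
part 07) are ALREADY tree theorems — `Summit.Schanuel.Schanuel.Theorems.RootDecomp1EGenericScale.defectOneSchanuel_iff` /
`eStableDefectOne_iff` / `plainDefectOne_iff` (RootDecomp1EGenericScale05, census gen 16 port) — and are NOT restated here
(gate dedup); the link below applies the live item 25020 to the class directly.  Nothing here proves any item; rung 0. -/

section LiveItems

open Summit.Schanuel.Schanuel.Theses.RootDecomp1E (DefectOneSchanuel EStableDefectOne PlainDefectOne)

/-- The LIVE item 25020 implies its `InLWClass` cell (trivially, by restriction) — and conversely the cell is what
`cell_25020 hLW` PROVES; recorded so the tree links the cell to the live decl. -/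
theorem cell_25020_of_defectOneSchanuel (h : DefectOneSchanuel) : ∀ (n : ℕ) (z : Fin n → ℂ), LinearIndependent ℚ z →
    InLWClass z →
      (n : Cardinal) ≤ Algebra.trdeg ℚ
        ↥(IntermediateField.adjoin ℚ (Set.range z ∪ Set.range (Complex.exp ∘ z))) + 1 :=
  fun n z hli _ => h n z hli

end LiveItems

/-! ## §9  The SEPARATION read against the TREE classes (port addition; critic VERDICT L1909 (f)): the HOME file's
`Sep.*` predicates are character-identical copies of the tree's lens-2 classes (g35 `RootDecomp1EScaleTransfer.InScaleClass`,
g36 `RootDecomp1EPointTransfer.InPointClass`, g37 `RootDecomp1ETwoScale.CoveredTower` / `InTwoScaleClass`); the `Iff.rfl`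
bridges below certify it, and the four separation theorems of part 08 are restated against the tree decls. -/

section TreeClassBridges

/-- `Sep.InScaleClass` IS the tree's g35 class (`Iff.rfl`). -/
theorem Sep.inScaleClass_iff {n : ℕ} (z : Fin n → ℂ) :
    Sep.InScaleClass z ↔ Summit.Schanuel.Schanuel.Theorems.RootDecomp1EScaleTransfer.InScaleClass z := Iff.rfl

/-- `Sep.InPointClass` IS the tree's g36 class (`Iff.rfl`). -/
theorem Sep.inPointClass_iff {n : ℕ} (z : Fin n → ℂ) :
    Sep.InPointClass z ↔ Summit.Schanuel.Schanuel.Theorems.RootDecomp1EPointTransfer.InPointClass z := Iff.rfl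

/-- `Sep.CoveredTower` IS the tree's g37 window-of-scales predicate (`Iff.rfl`). -/
theorem Sep.coveredTower_iff (ρ : ℝ) :
    Sep.CoveredTower ρ ↔ Summit.Schanuel.Schanuel.Theorems.RootDecomp1ETwoScale.CoveredTower ρ := Iff.rfl

/-- `Sep.InTwoScaleClass` IS the tree's g37 class (`Iff.rfl`). -/
theorem Sep.inTwoScaleClass_iff (z : Fin 4 → ℂ) :
    Sep.InTwoScaleClass z ↔ Summit.Schanuel.Schanuel.Theorems.RootDecomp1ETwoScale.InTwoScaleClass z := Iff.rfl

/-- SEPARATION vs the TREE g35 class: `z₄ ∉ InScaleClass`. -/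
theorem not_inScaleClass_zStar_tree :
    ¬ Summit.Schanuel.Schanuel.Theorems.RootDecomp1EScaleTransfer.InScaleClass zStar :=
  fun h => not_inScaleClass_zStar ((Sep.inScaleClass_iff zStar).mpr h)

/-- SEPARATION vs the TREE g36 class: `z₄ ∉ InPointClass`. -/
theorem not_inPointClass_zStar_tree :
    ¬ Summit.Schanuel.Schanuel.Theorems.RootDecomp1EPointTransfer.InPointClass zStar :=
  fun h => not_inPointClass_zStar ((Sep.inPointClass_iff zStar).mpr h)

/-- SEPARATION vs the TREE g37 window: `T⋆` is not a covered tower. -/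
theorem not_coveredTower_Tstar_tree :
    ¬ Summit.Schanuel.Schanuel.Theorems.RootDecomp1ETwoScale.CoveredTower Tstar :=
  fun h => not_coveredTower_Tstar ((Sep.coveredTower_iff Tstar).mpr h)

/-- SEPARATION vs the TREE g37 class: `z₄ ∉ InTwoScaleClass`. -/
theorem not_inTwoScaleClass_zStar_tree :
    ¬ Summit.Schanuel.Schanuel.Theorems.RootDecomp1ETwoScale.InTwoScaleClass zStar :=
  fun h => not_inTwoScaleClass_zStar ((Sep.inTwoScaleClass_iff zStar).mpr h)

end TreeClassBridges

end Summit.Schanuel.Schanuel.Theorems.RootDecomp1ELWTransport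

end
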